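/- Copyright: the b2b-balaban cell (near-miss cell 7), T⁴-continuum fan-out, lineage t4-ne7b-formalise-leaf-04 (NE7b
CRUX team (2), leaf prover 04) on the row-NE7b OWNER's INTERFACE REQUEST NE7b IR-41-8 «M2 brick B», part 2 of 2.
Released under the licence of the surrounding project. -/
import Summits.QuantumFields.BalabanUV.T4Continuum.Support.B16HistoryIndexedFamily
import Summits.QuantumFields.BalabanUV.T4Continuum.Support.HistoryGenealogyJunctionFamily
import Summits.QuantumFields.BalabanUV.T4Continuum.Support.HistoryGenealogyPedigreeEvProd

/-!
# M2 brick B: THE INPUT FAMILY READ OFF THE HISTORIES OF (1.72), the displayed identification `HistRead`, and the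
term weights BOUNDED BY THE EVENT PRODUCTS ALONG THE PROCESS'S PEDIGREE (`weight_le_evProd`) — re-open object (α) of
row NE7b, `SCOPE-alpha.md` v2.3 §5 row M2, brick B; INTERFACE REQUEST NE7b IR-41-8 of the row owner `t4-ne7b-p1` gen 41
(`HOME/INBOX.md` block 06:1xZ «→ leaf-04 (M2 brick B, spec)»); lineage `t4-ne7b-formalise-leaf-04` gen 25 — PRE-POSITIONING
ONLY

Summits-side support leaf of the T⁴-continuum cell (rung (B)+1 on a FINITE torus only; NOT infinite volume, NOT the
mass gap, NOT Clay; NOT a proof of NE7b — the cell's OWN estimate, NOT PRINTED, NOT PROVED).  [folklore] finite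
combinatorics + Bochner bookkeeping over M1∕M2-A (`B16HistoryIndexedRepr`: `HIndex`, `Repr172R`, `abs_eterm_le`;
`B16HistoryIndexedFamily`: `Idx`, `termSet`, `weight`, `abs_weight_le`), the owner's M4 (`HistoryGenealogyJunctionFamily`:
`InputFamily`, `realisedDomainsRW_of_family`; `HistoryGenealogyJunction`: `RunInputM.pedM`), leaf-05's process
(`HistoryGenealogyInstantiateM*`: `RunInputM`, `histM`, `rnwM`, `wf_histM`), the owner's ledger
(`HistoryGenealogyExtractionRLedger`: `evProd`, `rfacs`, `died`, `forest_evProd_eqR`) and part 1 of this request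
(`HistoryGenealogyPedigreeEvProd`: `RunInputM.evProd_pedM_eq_pgenR`); nothing printed is asserted, no `def … : Prop` fact of
Bałaban's, no cite-tagged hypothesis, zero `sorry`.  B16 = [Balaban1989LargeFieldII] pp. 378–387 is a manuscript UNDER
AUDIT: (1.71)∕(1.72) pp. 378–379, (1.79) p. 383, p. 384's sentence on the product of the (1.79)-factors connected
with a component and (1.89) p. 387 are quoted as LOCATORS of the displayed clauses, nothing else.

WHY.  The END of route R-P1 (`HistoryRealiseCellsRunApexT3bW.CountRoadWitnessT3bW`) wants, per cutoff `K`, ONE term set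
`T K` with weights `A K t τ` (M2-A: `termSet I K`, `weight μ R t τ`), the reading maps `ped`∕`liveC`∕`Zd` with
`realised : RealisedDomainsRW …` (M4: `InputFamily.ped`∕`liveC`∕`Z`, `realisedDomainsRW_of_family`), and the numerator
reading `upM : A K t τ ≤ dead · FcM · nup` whose live price `FcM` M5 banks into `pshapeTH`.  The two halves meet when the
INPUT of print's process (new regions, classes, new-field cubes, flow, readiness memory) is READ OFF the index of a term
— the outer summand `a = (Z_K, {Y_i})` and the history choice `ι = (h, ℓ, c)` of (1.72) (the admissible sequence of `Z_K`:
structures live at `K`; the sub-histories inside the `Y_i`: structures live and ready at `K`; the curly summand's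
first-class material: renormalised before `K`, a normalisation) — so that `Φ : InputFamily d (Idx I)` is indexed by M2-A's
own term type, and when the small factors the history operation and the `Y`-composite of the choice carry are, together,
those of THAT process's components.

WHAT.  §1 (data) **`HistReading I d`** — per cutoff `K`, outer summand `a` and history choice `ι` of M1's skeleton:
`N K a ι`, `cls K a ι`, `F K a ι`, common flow `L`, `s K`, `R K`, memory `Rm K`; `runOf K a ι : RunInputM d`; **`inputOf :
InputFamily d (Idx I)`** (`run_inputOf`: the run of the term `⟨K, a, ι⟩` at its cutoff IS `runOf K a ι`, `rfl`; idem
`ped_inputOf`, `liveC_inputOf`, `Z_inputOf`).  §2 = part 1 (`HistoryGenealogyPedigreeEvProd`, kernel): the event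
product of the END-currency genealogy `pedM.toPGen id (j, c)` IS print's extraction's (`RunInputM.evProd_pedM_eq_pgenR`,
any admissible order; the owner's binders `NewOK`, `Rm ≤ R` make the chosen order admissible).  §3 (displayed)
**`HistFactors I d`** (data: the VALUES `fB K`, `fR K` of the per-event factors and the per-cube level cost `Λ K j ≥ 1`
(`one_le_Λ`) of run `K` — a component's level cost is `Λ K j ^ #(its domain)` BY DEFINITION, the volume form; the
unit-weight envelopes `wZ`, `wY`, `wC` of the three operations of a choice and the upper envelopes `BA`, `BV`) and
**`HistRead ℛ Φf R l₀ K₀ : Prop`** — the envelopes as displays (`χ01`, `tz_le`, `ty_le`, `tc_le`, `A'_le`, `Vs_le`: M1's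
`abs_eterm_le` hypotheses) and THE IDENTIFICATION `forest_le`: «`wZ · wY ≤` the level-by-level product, over the
components of `(runOf K a ι).histM`, of `levelFactor` = `Λ K j ^ #(domain)` · (renewal factors of the renewed parts) ·
(birth factors of the new regions)» — the large-field structures of `Z_K`'s history (live at `K`) and of the `Y_i`'s
sub-histories (live and ready at `K`) ARE the components of the process; the curly summand (first-class material, a
NORMALISATION by (1.97)–(1.100)) and the completed action are envelope — the reading, onto OUR process, of (1.79) p. 383,
p. 384 and (1.89)∕(1.102) pp. 387∕390 (R-class; locators only).  §4 (kernel) **`weight_le_evProd_mk`** ∕ **`weight_le_evProd`**: under `HistRead`, the process conditions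
`NewOK` and `Rm ≤ R` (the owner's binders, verbatim) and finite reference measures, for `K₀ ≤ K`, `|t| ≤ l₀`,
`τ ∈ termSet I K`: `weight μ R t τ ≤ (∏_{j ≤ K} ∏_{c ∈ comp j} Λ K j ^ #c.2) · ((∏_{c ∈ inputOf.liveC K τ} evProd (fB K)
(fR K) ((inputOf.ped K τ).toPGen id c)) · ∏_{j < K} ∏_{c ∈ died j} evProd (fB K) (fR K) ((inputOf.ped K τ).toPGen id
(j, c))) · rest` — U1 integrated, with the GAIN factors re-indexed along `pedM`'s events by the forest identity and part 1
(live members: what M5 prices; dead genealogies and `rest = e^{BA} · wC · e^{BV} · mass`: the END's `dead`∕`nup` side; the level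
costs stay in the volume form `Λ K j ^ #(domain)` per (level, named component) for M5's `life` regrouping).  §5 (kernel junction test) **`realisedDomainsRW_inputOf`** = the
owner's `realisedDomainsRW_of_family` at `Φ := inputOf`, `T := termSet I`.

NOT HERE (honest).  The clauses of `HistRead` (the reading itself), M5's banking of the event products into `pshapeTH`,
the dead-part resummation `resumM`, (1.72)-holds and integrability (M2-A's displays), the torus placement `InBoxOK` and
«no fresh clusters» (displayed, as in M4).  BY-NAME EFFECT ON THE WALL: NONE (pre-positioning).  HONEST DEPENDENCY
(cell): continuum YM on T⁴ ⇐ BetaPertH ∧ nine spine estimates (0/9 proved); BetaPertH ⇐ (D1) ∧ (D4) ∧ CAP+tail; G-an2-4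
gates asym, D1 and NE2/3/4.  This file changes none of it.
-/

open Finset MeasureTheory
open Literature.MathematicalPhysics.QuantumFieldTheory.Balaban1983to89
open Literature.MathematicalPhysics.QuantumFieldTheory.Balaban1983to89.B13ScaleTransfer
open Summit.QuantumFields.BalabanUV.T4Continuum.HistoryAdmissible
open Summit.QuantumFields.BalabanUV.T4Continuum.HistoryGen
open Summit.QuantumFields.BalabanUV.T4Continuum.HistoryGenealogyExtraction
open Summit.QuantumFields.BalabanUV.T4Continuum.HistoryGenealogyRealise
open Summit.QuantumFields.BalabanUV.T4Continuum.HistoryGenealogyInstantiate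
open Summit.QuantumFields.BalabanUV.T4Continuum.HistoryGenealogyPedigree
open Summit.QuantumFields.BalabanUV.T4Continuum.HistoryRealiseWeakCells

namespace Summit.QuantumFields.BalabanUV.T4Continuum.B16HistoryIndexedRepr

noncomputable section

/-! ## §1 The input of print's process READ OFF the histories of (1.72), and the input family it defines -/

variable {DomK : ℕ → Type*}

/-- **THE READING DATA**: for every cutoff `K`, outer summand `a = (Z_K, {Y_i})` of the cutoff-`K` skeleton and history
choice `ι = (h, ℓ, c)` of (1.72) p. 379 (locator) — `h` the admissible sequence `{Ω^c_j, Z_j}` of the new region, `ℓ` the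
sub-histories (1.71) inside the `Y_i`, `c` the curly summand — the INPUT OF PRINT'S PROCESS it determines: new
large-field regions `N K a ι j` of every level `j` with classes `cls K a ι`, new-field cubes `F K a ι j` of the
preparatory operations, and the common flow of the run with cutoff `K` (blocking `L`, exponents `s K`, sizes `R K`) with
its readiness memory `Rm K`.  Pure data, indexed by the full choice so that no reading is foreclosed (typically read off
`(h, ℓ)`: the structures live at `K` and those live and ready at `K`; the curly summand's first-class material is
envelope): WHICH regions a choice names is the reading M2 owes; nothing asserted. [folklore] -/
structure HistReading (I : (K : ℕ) → HIndex (DomK K)) (d : ℕ) where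
  /-- blocking parameter -/
  L : ℕ
  /-- size exponents of the run with cutoff `K` -/
  s : ℕ → ℕ → ℕ
  /-- sizes `R_j` of the run with cutoff `K` -/
  R : ℕ → ℕ → ℕ
  /-- readiness memory of the run with cutoff `K` -/
  Rm : ℕ → ℕ → ℕ → ℕ
  /-- new regions of the history choice `ι` of summand `a` at cutoff `K`, per level -/
  N : (K : ℕ) → (a : (I K).Adm) → (I K).HZ × (I K).HL × (I K).HC → ℕ → Finset (Lab d)
  /-- classes of those regions -/
  cls : (K : ℕ) → (a : (I K).Adm) → (I K).HZ × (I K).HL × (I K).HC → Lab d → ℕ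
  /-- new-field cubes of the history choice, per level -/
  F : (K : ℕ) → (a : (I K).Adm) → (I K).HZ × (I K).HL × (I K).HC → ℕ → Finset (Pt d)

namespace HistReading

variable {I : (K : ℕ) → HIndex (DomK K)} {d : ℕ} (ℛ : HistReading I d)

/-- **THE RUN READ OFF A HISTORY CHOICE**: the input of print's memory-generic process for the choice `ι` of summand `a`
at cutoff `K`. [folklore] -/
def runOf (K : ℕ) (a : (I K).Adm) (ι : (I K).HZ × (I K).HL × (I K).HC) : RunInputM d :=
  { L := ℛ.L, s := ℛ.s K, R := ℛ.R K, N := ℛ.N K a ι, cls := ℛ.cls K a ι, F := ℛ.F K a ι, Rm := ℛ.Rm K }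

/-- **THE INPUT FAMILY INDEXED BY THE TERMS** (`inputOf`): a term `τ = ⟨K, a, ι⟩` of M2-A's K-uniform index type carries
its cutoff, summand and history choice, off which its regions, classes and new-field cubes are read; the flow and the
memory are the cutoff's. [folklore] -/
def inputOf : InputFamily d (HIndex.Idx I) where
  L := ℛ.L
  s := ℛ.s
  R := ℛ.R
  Rm := ℛ.Rm
  N := fun _ τ => ℛ.N τ.1 τ.2.1 τ.2.2
  cls := fun _ τ => ℛ.cls τ.1 τ.2.1 τ.2.2
  F := fun _ τ => ℛ.F τ.1 τ.2.1 τ.2.2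

/-- the run of the term `⟨K, a, ι⟩` at its own cutoff IS the run read off its history choice [folklore] -/
@[simp] theorem run_inputOf (K : ℕ) (a : (I K).Adm) (ι : (I K).HZ × (I K).HL × (I K).HC) :
    ℛ.inputOf.run K ⟨K, a, ι⟩ = ℛ.runOf K a ι := rfl

/-- its pedigree [folklore] -/
theorem ped_inputOf (K : ℕ) (a : (I K).Adm) (ι : (I K).HZ × (I K).HL × (I K).HC) :
    ℛ.inputOf.ped K ⟨K, a, ι⟩ = (ℛ.runOf K a ι).pedM := rfl

/-- its live names [folklore] -/
theorem liveC_inputOf (K : ℕ) (a : (I K).Adm) (ι : (I K).HZ × (I K).HL × (I K).HC) :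
    ℛ.inputOf.liveC K ⟨K, a, ι⟩ = ((ℛ.runOf K a ι).histM.comp K).image (Prod.mk K) := rfl

/-- its last-event domains [folklore] -/
theorem Z_inputOf (K : ℕ) (a : (I K).Adm) (ι : (I K).HZ × (I K).HL × (I K).HC) (x : ℕ × Lab d) :
    ℛ.inputOf.Z K ⟨K, a, ι⟩ x = (ℛ.runOf K a ι).ZM x.1 x.2 := rfl

/-! ## §5 (kernel junction test) The END's domain carrier over the term sets of M2-A -/

/-- **THE READ INPUT FAMILY MEETS THE END's CARRIER OVER M2-A's TERM SETS**: the owner's `realisedDomainsRW_of_family` at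
`Φ := inputOf`, `T := termSet I` — under the displayed per-term process conditions, the pedigrees, live names and
last-event domains of the runs read off the histories form `RealisedDomainsRW` (types line up with `weight μ R t` over
the same `termSet I K`). [folklore] -/
theorem realisedDomainsRW_inputOf (n K₀ : ℕ)
    (hN : ∀ K, K₀ ≤ K → ∀ τ ∈ HIndex.termSet I K, (ℛ.inputOf.run K τ).NewOK)
    (hRm : ∀ K, K₀ ≤ K → ∀ τ ∈ HIndex.termSet I K, ∀ t k, (ℛ.inputOf.run K τ).Rm t k ≤ (ℛ.inputOf.run K τ).R t)
    (hNF : ∀ K, K₀ ≤ K → ∀ τ ∈ HIndex.termSet I K, NoFreshClusters (ℛ.inputOf.run K τ).histM)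
    (hbox : ∀ K, K₀ ≤ K → ∀ τ ∈ HIndex.termSet I K, (ℛ.inputOf.run K τ).InBoxOK n K) :
    RealisedDomainsRW ℛ.L ℛ.s n K₀ ℛ.R (HIndex.termSet I) ℛ.inputOf.ped (fun _ _ => id) ℛ.inputOf.liveC
      ℛ.inputOf.Z :=
  ℛ.inputOf.realisedDomainsRW_of_family (HIndex.termSet I) n K₀ hN hRm hNF hbox

end HistReading

/-! ## §3 The factor values and envelopes, and the displayed identification `HistRead` -/

/-- **THE FACTOR VALUES OF THE RUNS AND THE ENVELOPES OF THE OPERATIONS** (data): for the run with cutoff `K`, the birth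
factor `fB K j d′ n` of a new region `n` of class `d′` at level `j`, the renewal factor `fR K j` of a part renewed by the
level-`j` 𝐑-operation, and the PER-CUBE level cost `Λ K j ≥ 1` (displayed `one_le_Λ`) — a component's level cost is
`Λ K j ^ #(its domain)` BY DEFINITION (p. 380: a large-field domain `Z_j` costs the volume `O(1)·log g_j⁻²·|Z_j|`, i.e.
`Λ K j = exp(O(1) log g_j⁻²)` per `MR_j`-cube, the `d′_j` form being its bound; the row owner's SHAPE ANSWER, journal
l.28595: M5 reads a live structure's realised cost at a level as `log Λ · #(domain)` and regroups along the END's `life`;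
under pass V `Λ^{#c.2} = ∏_{n} Λ^{#n.2}` over a fresh cluster's disjoint regions is an identity) — the shapes in which
(1.79) p. 383 attaches its three kinds of factors; VALUES as functions of the running couplings are balaban-calc's ∕ M5's,
nothing fixed here; and, per source value `t`, the unit-weight envelopes of the three history-indexed operations of a
choice (`wZ` of `𝐓″_{K,h}`, `wY` of the `Y`-composite `ℓ` — the two that carry small factors —, `wC` of the curly
composite `c` — a normalisation) and the upper envelopes of the completed action and of the last exponent (M1's
`abs_eterm_le` data). [folklore] -/
structure HistFactors (I : (K : ℕ) → HIndex (DomK K)) (d : ℕ) where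
  /-- birth factor of run `K`: level, class, region -/
  fB : ℕ → ℕ → ℕ → Lab d → ℝ
  /-- renewal factor of run `K`: level of the renewing 𝐑-operation -/
  fR : ℕ → ℕ → ℝ
  /-- per-cube level cost of run `K` at level `j` (a component of domain `D` costs `Λ K j ^ #D`) -/
  Λ : ℕ → ℕ → ℝ
  /-- the per-cube cost is at least one (displayed) -/
  one_le_Λ : ∀ K j, 1 ≤ Λ K j
  /-- unit-weight envelope of the history operation `h` of summand `a` -/
  wZ : (K : ℕ) → ℝ → (a : (I K).Adm) → (I K).HZ → ℝ
  /-- unit-weight envelope of the `Y`-composite `ℓ` of summand `a` -/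
  wY : (K : ℕ) → ℝ → (a : (I K).Adm) → (I K).HL → ℝ
  /-- unit-weight envelope of the curly composite `c` of summand `a` -/
  wC : (K : ℕ) → ℝ → (a : (I K).Adm) → (I K).HC → ℝ
  /-- upper envelope of the completed action -/
  BA : ℕ → ℝ → ℝ
  /-- upper envelope of the last exponent of the full choice -/
  BV : (K : ℕ) → ℝ → (a : (I K).Adm) → (I K).HZ → (I K).HL → (I K).HC → ℝ

namespace HistFactors

variable {I : (K : ℕ) → HIndex (DomK K)} {d : ℕ} (Φf : HistFactors I d)

/-- **THE LEVEL FACTOR OF A COMPONENT** of a component history `H` with renewal flags `rnw`, run `K`, level `j`: the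
level cost of its DOMAIN in volume form `Λ K j ^ #c.2` (the label carries the domain: `c.2`) times the renewal factors of
its renewed parts times the birth factors of its new regions — the summand shape of the forest identity
`forest_evProd_eqR`, with the cost in front. [folklore] -/
def levelFactor (H : ComponentHistory (Lab d)) (rnw : ℕ → Lab d → Bool) (K j : ℕ) (c : Lab d) : ℝ :=
  Φf.Λ K j ^ (c.2).card * (H.rfacs rnw (Φf.fR K) j c * ((H.news j c).map fun n => Φf.fB K j (H.cls n) n).prod)

/-- a level factor's cost part is at least one (`one_le_Λ`) [folklore] -/
theorem one_le_Λ_pow (K j n : ℕ) : 1 ≤ Φf.Λ K j ^ n := one_le_pow₀ (Φf.one_le_Λ K j)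

/-- **THE LEVEL-BY-LEVEL PRODUCT OF THE LEVEL FACTORS, REGROUPED ALONG THE PEDIGREE** — for ANY component history `H`
with `WF`, renewal flags `rnw` and admissible order `ord` (so for the process `histM` and, verbatim, for any second
bookkeeping the owner derives from it): `∏_{j ≤ K} ∏_{c ∈ comp j} levelFactor = (∏_{j ≤ K} ∏_{c ∈ comp j} Λ K j ^ #c.2) ·
((∏_{c ∈ comp K} evProd (fB K) (fR K) ((pedOf H rnw ord).toPGen id (K, c))) · ∏_{j < K} ∏_{c ∈ died j} evProd (fB K) (fR K)
((pedOf H rnw ord).toPGen id (j, c)))` — the owner's forest identity `forest_evProd_eqR` and part 1's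
`evProd_toPGen_id_eq_pgenR`. [folklore] -/
theorem prod_levelFactor_eq {H : ComponentHistory (Lab d)} {rnw : ℕ → Lab d → Bool}
    {ord : ℕ → Lab d → List (Lab d ⊕ Lab d)} (hW : H.WF) (hO : OrderOK H ord) (K : ℕ) :
    (∏ j ∈ Finset.range (K + 1), ∏ c ∈ H.comp j, Φf.levelFactor H rnw K j c) =
      (∏ j ∈ Finset.range (K + 1), ∏ c ∈ H.comp j, Φf.Λ K j ^ (c.2).card) *
        ((∏ c ∈ H.comp K, evProd (Φf.fB K) (Φf.fR K) ((pedOf H rnw ord).toPGen id (K, c))) *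
          ∏ j ∈ Finset.range K, ∏ c ∈ H.died j, evProd (Φf.fB K) (Φf.fR K) ((pedOf H rnw ord).toPGen id (j, c))) := by
  have h1 : (∏ j ∈ Finset.range (K + 1), ∏ c ∈ H.comp j, Φf.levelFactor H rnw K j c) =
      (∏ j ∈ Finset.range (K + 1), ∏ c ∈ H.comp j, Φf.Λ K j ^ (c.2).card) *
        ∏ j ∈ Finset.range (K + 1), ∏ c ∈ H.comp j,
          (H.rfacs rnw (Φf.fR K) j c * ((H.news j c).map fun n => Φf.fB K j (H.cls n) n).prod) := by
    rw [← Finset.prod_mul_distrib]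
    exact Finset.prod_congr rfl fun j _ => Finset.prod_mul_distrib
  have hlive : (∏ c ∈ H.comp K, evProd (Φf.fB K) (Φf.fR K) (H.pgenR rnw K c)) =
      ∏ c ∈ H.comp K, evProd (Φf.fB K) (Φf.fR K) ((pedOf H rnw ord).toPGen id (K, c)) :=
    Finset.prod_congr rfl fun c hc => (evProd_toPGen_id_eq_pgenR (Φf.fB K) (Φf.fR K) hW hO hc).symm
  have hdead : (∏ j ∈ Finset.range K, ∏ c ∈ H.died j, evProd (Φf.fB K) (Φf.fR K) (H.pgenR rnw j c)) =
      ∏ j ∈ Finset.range K, ∏ c ∈ H.died j, evProd (Φf.fB K) (Φf.fR K) ((pedOf H rnw ord).toPGen id (j, c)) :=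
    Finset.prod_congr rfl fun j _ => Finset.prod_congr rfl fun c hc =>
      (evProd_toPGen_id_eq_pgenR (Φf.fB K) (Φf.fR K) hW hO (Finset.mem_sdiff.1 hc).1).symm
  rw [h1, ← H.forest_evProd_eqR rnw (Φf.fB K) (Φf.fR K) hW K, hlive, hdead]

/-- the same for the process run on an input: `pedM`, under the owner's binders `NewOK`, `Rm ≤ R` (which make the chosen
order `ordM` admissible) [folklore] -/
theorem prod_levelFactor_eq_pedM (J : RunInputM d) (hN : J.NewOK) (hRm : ∀ t k, J.Rm t k ≤ J.R t) (K : ℕ) :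
    (∏ j ∈ Finset.range (K + 1), ∏ c ∈ J.histM.comp j, Φf.levelFactor J.histM J.rnwM K j c) =
      (∏ j ∈ Finset.range (K + 1), ∏ c ∈ J.histM.comp j, Φf.Λ K j ^ (c.2).card) *
        ((∏ c ∈ J.histM.comp K, evProd (Φf.fB K) (Φf.fR K) (J.pedM.toPGen id (K, c))) *
          ∏ j ∈ Finset.range K, ∏ c ∈ J.histM.died j, evProd (Φf.fB K) (Φf.fR K) (J.pedM.toPGen id (j, c))) :=
  Φf.prod_levelFactor_eq (J.wf_histM hN) (orderOK_ordOf (J.wf_histM hN) (J.levelClausesW_histM hN hRm)) K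

/-- **THE REST OF A TERM's ENVELOPE** (the normalisations — what is not a small factor of a large-field structure):
`e^{BA} · wC · e^{BV}` times the total mass of the cutoff's reference measure. [folklore] -/
def rest (mass : ℕ → ℝ) (t : ℝ) : HIndex.Idx I → ℝ
  | ⟨K, a, (h, l, c)⟩ => Real.exp (Φf.BA K t) * (Φf.wC K t a c * Real.exp (Φf.BV K t a h l c)) * mass K

end HistFactors

section Read

variable {I : (K : ℕ) → HIndex (DomK K)} {d : ℕ} {X : ℕ → Type*} {𝒢 : (K : ℕ) → GoodClass (X K)}

/-- **`HistRead` — THE DISPLAYED IDENTIFICATION** of (1.72)'s history-indexed operations with print's process run on the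
input read off the history choices (R-class READING; every clause a hypothesis SHAPE, NOTHING of Bałaban's asserted):
* `forest_le` — «the large-field structures of the term `⟨K, a, ι⟩` ARE the components of `(runOf K a ι).histM`, level by
  level; those of `Z_K`'s history `h` live at `K`, those of the sub-histories `ℓ` inside the `Y_i` live and ready at
  `K`»: the product of the unit-weight envelopes of the history operation and of the `Y`-composite of the choice is at
  most the product over the levels `j ≤ K` and the components `c ∈ comp j` of that process of `levelFactor` — per-level
  cost `Λ K j ^ #(domain)`, one renewal factor per renewed part, one birth factor per new region (the reading, onto OUR process, of (1.79)
  p. 383 «for the 𝐓-operation connected with an arbitrary large field region», of p. 384 «the product of all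
  (1.79)-factors … connected with a component» and of (1.89)∕(1.102) pp. 387∕390 for the renormalised `Y`-operations —
  locators only); the curly composite `wC` (first-class material, resummed by (1.97)–(1.100) into a normalisation) and
  the completed action stay ENVELOPE (`rest`);
* `χ01`, `tz_le`, `ty_le`, `tc_le`, `A'_le`, `Vs_le` — the characteristic function in `[0,1]` and the envelopes
  themselves (M1's `abs_eterm_le` hypotheses as displays), for `|t| ≤ l₀`, `K ≥ K₀`. [folklore] -/
structure HistRead (ℛ : HistReading I d) (Φf : HistFactors I d) (R : (K : ℕ) → ℝ → Repr172R (𝒢 K) (I K)) (l₀ : ℝ)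
    (K₀ : ℕ) : Prop where
  /-- characteristic functions take values in `[0, 1]` -/
  χ01 : ∀ K t a V, 0 ≤ (R K t).χ a V ∧ (R K t).χ a V ≤ 1
  /-- unit-weight envelope of the history operations -/
  tz_le : ∀ K t, |t| ≤ l₀ → K₀ ≤ K → ∀ a, ∀ h ∈ (I K).HZs a, ∀ W, ((R K t).TZh a h).T (fun _ => 1) W ≤ Φf.wZ K t a h
  /-- unit-weight envelope of the `Y`-composites -/
  ty_le : ∀ K t, |t| ≤ l₀ → K₀ ≤ K → ∀ a, ∀ l ∈ (I K).HYs a, ∀ W, ((R K t).TYl a l).T (fun _ => 1) W ≤ Φf.wY K t a l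
  /-- unit-weight envelope of the curly composites -/
  tc_le : ∀ K t, |t| ≤ l₀ → K₀ ≤ K → ∀ a, ∀ c ∈ (I K).HCs a, ∀ W, ((R K t).TC a c).T (fun _ => 1) W ≤ Φf.wC K t a c
  /-- upper envelope of the completed action -/
  A'_le : ∀ K t, |t| ≤ l₀ → K₀ ≤ K → ∀ W, (R K t).A' W ≤ Φf.BA K t
  /-- upper envelope of the last exponent -/
  Vs_le : ∀ K t, |t| ≤ l₀ → K₀ ≤ K → ∀ a h l c W, (R K t).Vs a h l c W ≤ Φf.BV K t a h l c
  /-- THE IDENTIFICATION: the envelopes of the history operation and of the `Y`-composite of a history choice are,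
  together, at most the level-by-level product of the level factors of the components of the process run on the input
  read off that choice -/
  forest_le : ∀ K t, |t| ≤ l₀ → K₀ ≤ K → ∀ a, ∀ ι ∈ (I K).LIdx a,
    Φf.wZ K t a ι.1 * Φf.wY K t a ι.2.1 ≤
      ∏ j ∈ Finset.range (K + 1), ∏ c ∈ (ℛ.runOf K a ι).histM.comp j,
        Φf.levelFactor (ℛ.runOf K a ι).histM (ℛ.runOf K a ι).rnwM K j c

/-! ## §4 The weight of a term is bounded by the event products along the process's pedigree -/

/-- **THE WEIGHT OF A TERM IS BOUNDED BY THE EVENT PRODUCTS ALONG `pedM`'s EVENTS** (U1 integrated and re-indexed;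
component form): under the displayed identification `HistRead`, the owner's process conditions `NewOK` and `Rm ≤ R` for
the run read off the choice (verbatim the binders of `realisedDomainsRW_of_family`; they make the chosen order
admissible) and finite reference measures, for `K₀ ≤ K`, `|t| ≤ l₀`, `(h, ℓ, c) ∈ LIdx a`:
`weight μ R t ⟨K, a, (h,ℓ,c)⟩ ≤ (∏_{j ≤ K} ∏_{c′ ∈ comp j} Λ K j ^ #c′.2) · ((∏_{c′ ∈ comp K} evProd (fB K) (fR K)
(pedM.toPGen id (K,c′))) · ∏_{j < K} ∏_{c′ ∈ died j} evProd (fB K) (fR K) (pedM.toPGen id (j,c′))) · (e^{BA} wC e^{BV} · mass)`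
— M2-A's `abs_weight_le` ∘ M1's `abs_eterm_le`, `forest_le`, and `prod_levelFactor_eq_pedM` (the owner's forest
identity `forest_evProd_eqR` + part 1's `evProd_pedM_eq_pgenR`). [folklore] -/
theorem weight_le_evProd_mk [∀ K, MeasurableSpace (X K)] (ℛ : HistReading I d) (Φf : HistFactors I d)
    (μ : (K : ℕ) → Measure (X K)) [∀ K, IsFiniteMeasure (μ K)] (R : (K : ℕ) → ℝ → Repr172R (𝒢 K) (I K))
    {l₀ : ℝ} {K₀ : ℕ} (hR : HistRead ℛ Φf R l₀ K₀) {K : ℕ} (hK : K₀ ≤ K) {t : ℝ} (ht : |t| ≤ l₀)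
    (a : (I K).Adm) {h : (I K).HZ} {l : (I K).HL} {c : (I K).HC} (hι : (h, l, c) ∈ (I K).LIdx a)
    (hN : (ℛ.runOf K a (h, l, c)).NewOK)
    (hRm : ∀ t k, (ℛ.runOf K a (h, l, c)).Rm t k ≤ (ℛ.runOf K a (h, l, c)).R t) :
    Repr172R.weight μ R t ⟨K, a, (h, l, c)⟩ ≤
      (∏ j ∈ Finset.range (K + 1), ∏ c' ∈ (ℛ.runOf K a (h, l, c)).histM.comp j, Φf.Λ K j ^ (c'.2).card) *
        ((∏ c' ∈ (ℛ.runOf K a (h, l, c)).histM.comp K,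
            evProd (Φf.fB K) (Φf.fR K) ((ℛ.runOf K a (h, l, c)).pedM.toPGen id (K, c'))) *
          ∏ j ∈ Finset.range K, ∏ c' ∈ (ℛ.runOf K a (h, l, c)).histM.died j,
            evProd (Φf.fB K) (Φf.fR K) ((ℛ.runOf K a (h, l, c)).pedM.toPGen id (j, c'))) *
        (Real.exp (Φf.BA K t) * (Φf.wC K t a c * Real.exp (Φf.BV K t a h l c)) * (μ K).real Set.univ) := by
  set J := ℛ.runOf K a (h, l, c) with hJ
  have hmem : h ∈ (I K).HZs a ∧ l ∈ (I K).HYs a ∧ c ∈ (I K).HCs a := by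
    simpa [HIndex.LIdx, Finset.mem_product] using hι
  have hF := hR.forest_le K t ht hK a (h, l, c) hι
  -- U1 per elementary term (M1) with the displayed envelopes, then the identification
  have hB : ∀ x, |(R K t).eterm a (h, l, c) x| ≤
      (∏ j ∈ Finset.range (K + 1), ∏ c' ∈ J.histM.comp j, Φf.levelFactor J.histM J.rnwM K j c') *
        (Real.exp (Φf.BA K t) * (Φf.wC K t a c * Real.exp (Φf.BV K t a h l c))) := by
    intro x
    have hwC : 0 ≤ Φf.wC K t a c := (((R K t).TC a c).one_nonneg x).trans (hR.tc_le K t ht hK a c hmem.2.2 x)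
    have hE : 0 ≤ Real.exp (Φf.BA K t) * (Φf.wC K t a c * Real.exp (Φf.BV K t a h l c)) :=
      mul_nonneg (Real.exp_pos _).le (mul_nonneg hwC (Real.exp_pos _).le)
    calc |(R K t).eterm a (h, l, c) x|
        ≤ Φf.wZ K t a h * (Real.exp (Φf.BA K t) * (Φf.wY K t a l * (Φf.wC K t a c * Real.exp (Φf.BV K t a h l c)))) :=
          (R K t).abs_eterm_le a (h, l, c) (fun V => hR.χ01 K t a V) (fun W => hR.tz_le K t ht hK a h hmem.1 W)
            (fun W => hR.ty_le K t ht hK a l hmem.2.1 W) (fun W => hR.tc_le K t ht hK a c hmem.2.2 W)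
            (hR.A'_le K t ht hK) (fun W => hR.Vs_le K t ht hK a h l c W) x
      _ = Φf.wZ K t a h * Φf.wY K t a l *
            (Real.exp (Φf.BA K t) * (Φf.wC K t a c * Real.exp (Φf.BV K t a h l c))) := by ring
      _ ≤ _ := mul_le_mul_of_nonneg_right hF hE
  -- U1 integrated (M2-A), then the gains regrouped along the process's pedigree
  have hw := Repr172R.abs_weight_le μ R t K a (h, l, c) hB
  have hP := Φf.prod_levelFactor_eq_pedM J hN hRm K
  calc Repr172R.weight μ R t ⟨K, a, (h, l, c)⟩ ≤ |Repr172R.weight μ R t ⟨K, a, (h, l, c)⟩| := le_abs_self _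
    _ ≤ _ := hw
    _ = _ := by rw [hP]; ring

/-- **THE WEIGHT OF A TERM IS BOUNDED BY THE EVENT PRODUCTS ALONG `pedM`'s EVENTS — END FORM**: for `τ ∈ termSet I K`,
with the owner's per-term binders `NewOK` ∕ `Rm ≤ R` over `T := termSet I` verbatim, the live product over
`inputOf.liveC K τ` and the pedigree `inputOf.ped K τ`, the dead product over the died components of `inputOf.run K τ`,
the per-level costs of the named components' domains in volume form, and the envelope `rest`. [folklore] -/
theorem weight_le_evProd [∀ K, MeasurableSpace (X K)] (ℛ : HistReading I d) (Φf : HistFactors I d)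
    (μ : (K : ℕ) → Measure (X K)) [∀ K, IsFiniteMeasure (μ K)] (R : (K : ℕ) → ℝ → Repr172R (𝒢 K) (I K))
    {l₀ : ℝ} {K₀ : ℕ} (hR : HistRead ℛ Φf R l₀ K₀)
    (hN : ∀ K, K₀ ≤ K → ∀ τ ∈ HIndex.termSet I K, (ℛ.inputOf.run K τ).NewOK)
    (hRm : ∀ K, K₀ ≤ K → ∀ τ ∈ HIndex.termSet I K, ∀ t k, (ℛ.inputOf.run K τ).Rm t k ≤ (ℛ.inputOf.run K τ).R t)
    {K : ℕ} (hK : K₀ ≤ K) {t : ℝ} (ht : |t| ≤ l₀) {τ : HIndex.Idx I} (hτ : τ ∈ HIndex.termSet I K) :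
    Repr172R.weight μ R t τ ≤
      (∏ j ∈ Finset.range (K + 1), ∏ c ∈ (ℛ.inputOf.run K τ).histM.comp j, Φf.Λ K j ^ (c.2).card) *
        ((∏ c ∈ ℛ.inputOf.liveC K τ, evProd (Φf.fB K) (Φf.fR K) ((ℛ.inputOf.ped K τ).toPGen id c)) *
          ∏ j ∈ Finset.range K, ∏ c ∈ (ℛ.inputOf.run K τ).histM.died j,
            evProd (Φf.fB K) (Φf.fR K) ((ℛ.inputOf.ped K τ).toPGen id (j, c))) *
        Φf.rest (fun K => (μ K).real Set.univ) t τ := by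
  obtain ⟨⟨a, h, l, c⟩, hp, hpe⟩ := Finset.mem_map.mp hτ
  have hτe : τ = ⟨K, a, (h, l, c)⟩ := hpe.symm
  subst hτe
  rw [HistReading.liveC_inputOf, Finset.prod_image fun x _ y _ hxy => (Prod.mk.inj hxy).2]
  exact weight_le_evProd_mk ℛ Φf μ R hR hK ht a (Finset.mem_sigma.mp hp).2 (hN K hK _ hτ) (hRm K hK _ hτ)

end Read

end

end Summit.QuantumFields.BalabanUV.T4Continuum.B16HistoryIndexedRepr
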